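import Summits.QuantumFields.YangMills.Theorems.BalabanUVNodesN22W1CouplingRadiiPhaseTower
import Mathlib.Analysis.Analytic.Uniqueness
import Mathlib.Analysis.Complex.CauchyIntegral

/-!
# BalabanUVNodes ∕ node N22 = NE9 — THE PHASE TOWER IS SHARP FOR THE GROWTH LETTER: at the phase tower NO coupling-analyticity margin in the coupling `g_i`
# exceeds `(2 + log(A′∕A))·ϱ·ω^{−(k+1−i)}` (identity theorem) — the Cauchy road cannot fade this tower's moduli faster than the phase rate `ω`

Cell `pub-ymgap`, HUMAN RULING D-0062 (Track A) ∕ D-0149, WIDTH SEAT `pub-ymgap-dag-n22-w1` (harness re-seat g3) on node n22 = NE9; `--kind proof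
--supports stmt-QuantumFields-20544 --as helper` (K3⁷ `SpineGivenEndpointR13SepCoPH`), COUNT-NEUTRAL.  THEOREMS ONLY (0 `def`, 0 `sorry`, standard axioms); imports
this seat's `…N22W1CouplingRadiiPhaseTower` (p611030) and Mathlib's identity theorem (`AnalyticOnNhd.eqOn_of_preconnected_of_frequently_eq`) ∕ Cauchy–Goursat
(`DifferentiableOn.analyticOnNhd`).

WHY.  Module `…PhaseTower` inhabits J31's «(2.38) on the young-coupling margin» with g2's GEOMETRIC radius table `ρ_{k,i} = ϱ·ω^{−(k+1−i)}`: the phase activity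
`H(Z; g) = A e^{−2} e^{−R d(Z)}·e^{iΣ g_i ω^{k+1−i}∕ϱ}` extends in `g_i` to the strip `|Im z| < 2ρ_{k,i}` under the amplitude `A e^{−R d(Z)}`.  THIS MODULE shows the
witness does not OVER-accommodate the letter: by the identity theorem ANY margin datum in the coordinate `i` at the phase step — a holomorphic `Hc` on `O ⊇ D̄(t, ρ′)` about ONE
point `t > 0`, bounded by `A′ e^{−R d(Z)}` on `O`, agreeing with `s ↦ H(Z; g|g_i := s; φ)` on `]0, t]` — coincides with the entire phase `c·e^{izf}` (`f = ω^{k+1−i}∕ϱ`) on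
the open disc, whose modulus at `t − iρ″` is `A e^{−2} e^{−Rd}·e^{fρ″}`; hence `ρ′·f ≤ 2 + log(A′∕A)`:

  «at the phase tower a Cauchy margin in the coupling `g_i` is at most `(2 + log(A′∕A))·ϱ·ω^{−(k+1−i)}`; at the SAME amplitude (`A′ = A`) at most `2ρ_{k,i}` —
   the strip of `coordHolo_phaseStep` is MAXIMAL»,

so on this tower the radii CANNOT grow faster in the age than geometrically at rate `ω⁻¹` (up to the amplitude logarithm), i.e. the Cauchy moduli `4A′∕ρ′` any margin
datum yields (J31 `youngLipschitz_box_of_coordHolo`) fade NO faster than `ω^{k+1−i}` — the rate of the tower's TRUE sensitivity `A e^{−2} e^{−Rd}·ω^{k+1−i}∕ϱ`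
(`norm_deriv_H_coord_phaseStep`).  With g2's `couplingRadii_of_fadingCauchyTable` ∕ `letterModuli_le_iff_radii` this closes the circle «fading rate of the Cauchy moduli =
growth rate of the radii = phase rate» on a concrete non-termless tower.

WHAT (all [folklore]: identity theorem + modulus of `e^{izf}`).  `margin_radius_le_phaseStep` (one coordinate, one base point `t > 0`, agreement on `]0, t]`),
`margin_radius_le_two_mul_phaseStep` (`A′ = A`: `ρ′ ≤ 2ρ_{k,i}`), `margin_table_le_phaseTower` (J31's level-`k` datum shape `hH` on a box `]0, γ]^{k+1}`, `γ > 0`, with ANY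
radius table `ρ′` and amplitude `A′` at the phase tower ⟹ `ρ′ (k+1) i · ω^{k+1−i}∕ϱ ≤ 2 + log(A′∕A)` for every `i ≤ k`).

HONEST FRAMING.  A statement about the MODEL tower of `…PhaseTower`, NOT about NODE 00's objects; count-neutral A6∕tightness helper; N22 NOT discharged (typed 28∕28 ·
discharged 5∕27 UNCHANGED — the chair's single count line is the only count); K3⁷ OPEN, NOT claimed; NE9 ∕ `FadingMemory` NOT IN PRINT for d = 4; one finite four-torus
programme at fixed ε — R4 closes the CONDITIONAL rung `BalabanLadder.UV` only; NOT infinite volume ∕ OS on ℝ⁴ ∕ mass gap ∕ Clay.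
References (TYPES only): [I] = [Balaban1987RG1] CMP **109** (1987) §1 p. 263; [II] = [Balaban1988RG2Cluster] CMP **116** (1988) Lemma 3 (2.38) p. 20.
-/

noncomputable section

namespace YMDAG.N22.W1.CouplingRadii.PhaseTower

open Set Metric Filter Topology
open scoped BigOperators
open Literature.MathematicalPhysics.QuantumFieldTheory.Balaban1983to89
open Literature.MathematicalPhysics.QuantumFieldTheory.Balaban1983to89.T4Continuum (T4Family)
open Literature.MathematicalPhysics.QuantumFieldTheory.Balaban1983to89.Node00
open Literature.MathematicalPhysics.QuantumFieldTheory.Balaban1983to89.Node00.Sect2 (domSys domCount CPair)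
open Literature.MathematicalPhysics.QuantumFieldTheory.Balaban1983to89.Node00.W1

section Step
variable {P : Params} {𝔸 : Type*} {M k : ℕ} (S : ClusterStep P 𝔸 M k) {A R ϱ ω : ℝ}
variable (hS : ∀ (g : Fin (k + 1) → ℝ) (φ : CPair P 𝔸) (Z : (domSys P M (k + 1)).Dom),
  S.H g φ Z = ((A * Real.exp (-2) * Real.exp (-(R * (domSys P M (k + 1)).dj Z)) : ℝ) : ℂ) *
    Complex.exp (Complex.I * ((∑ i : Fin (k + 1), g i * (ω ^ (k + 1 - (i : ℕ)) / ϱ) : ℝ) : ℂ)))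
include hS

/-- **★ SHARPNESS OF THE GROWTH LETTER AT THE PHASE STEP (identity theorem).**  At the phase step (`A > 0`, `ϱ, ω > 0`), fix a prefix `g`, a polymer `Z`, a
configuration `φ`, a coordinate `i` and ONE base point `t > 0`.  If `Hc` is complex-differentiable on a set `O ⊇ D̄(t, ρ′)` (`ρ′ > 0`), bounded on `O` by `A′ e^{−R d(Z)}`,
and agrees with `s ↦ H(Z; g|g_i := s; φ)` on `]0, t]`, then `ρ′ · ω^{k+1−i}∕ϱ ≤ 2 + log(A′∕A)`.  Proof: on the open disc `Hc` is analytic (Cauchy–Goursat) and agrees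
with the entire phase `c·e^{izf}` along the reals accumulating at `t`, hence everywhere on the disc (identity theorem); at `t − iρ″` (`ρ″ < ρ′`) the phase has modulus
`A e^{−2} e^{−Rd} e^{fρ″} ≤ A′ e^{−Rd}`. [folklore] -/
theorem margin_radius_le_phaseStep (hA : 0 < A) (hϱ : 0 < ϱ) (hω : 0 < ω) (g : Fin (k + 1) → ℝ) (φ : CPair P 𝔸) (Z : (domSys P M (k + 1)).Dom)
    (i : Fin (k + 1)) {t ρ' A' : ℝ} (ht : 0 < t) (hρ' : 0 < ρ') {Hc : ℂ → ℂ} {O : Set ℂ} (hdiff : DifferentiableOn ℂ Hc O)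
    (hball : closedBall (t : ℂ) ρ' ⊆ O) (hbound : ∀ z ∈ O, ‖Hc z‖ ≤ A' * Real.exp (-(R * (domSys P M (k + 1)).dj Z)))
    (hagree : ∀ s ∈ Ioc (0 : ℝ) t, Hc s = S.H (Function.update g i s) φ Z) :
    ρ' * (ω ^ (k + 1 - (i : ℕ)) / ϱ) ≤ 2 + Real.log (A' / A) := by
  set f : ℝ := ω ^ (k + 1 - (i : ℕ)) / ϱ with hf_def
  have hf : 0 < f := by positivity
  set c : ℂ := S.H (Function.update g i 0) φ Z with hc_def
  have hc : ‖c‖ = A * Real.exp (-2) * Real.exp (-(R * (domSys P M (k + 1)).dj Z)) := norm_H_phaseStep S hS hA.le _ φ Z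
  -- Step 1: `Hc` coincides with the entire phase on the open disc.
  have hBO : ball (t : ℂ) ρ' ⊆ O := ball_subset_closedBall.trans hball
  have hHc_an : AnalyticOnNhd ℂ Hc (ball (t : ℂ) ρ') := (hdiff.mono hBO).analyticOnNhd isOpen_ball
  have hE_an : AnalyticOnNhd ℂ (fun z => c * Complex.exp (Complex.I * (z * (f : ℂ)))) (ball (t : ℂ) ρ') :=
    ((differentiable_const _).mul (((differentiable_id.mul_const _).const_mul _).cexp)).differentiableOn.analyticOnNhd isOpen_ball
  have htend : Tendsto (fun n : ℕ => ((t - t / ((n : ℝ) + 2) : ℝ) : ℂ)) atTop (𝓝[≠] (t : ℂ)) := by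
    refine tendsto_nhdsWithin_iff.2 ⟨?_, Eventually.of_forall fun n => ?_⟩
    · have h1 : Tendsto (fun n : ℕ => t - t / ((n : ℝ) + 2)) atTop (𝓝 (t - 0)) :=
        tendsto_const_nhds.sub (tendsto_const_nhds.div_atTop (tendsto_atTop_add_const_right _ _ tendsto_natCast_atTop_atTop))
      rw [sub_zero] at h1
      exact (Complex.continuous_ofReal.tendsto t).comp h1
    · have hpos : 0 < t / ((n : ℝ) + 2) := by positivity
      rw [mem_compl_singleton_iff, Ne, Complex.ofReal_inj]
      intro h
      linarith
  have hfreq : ∃ᶠ z in 𝓝[≠] (t : ℂ), Hc z = c * Complex.exp (Complex.I * (z * (f : ℂ))) := by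
    refine htend.frequently (Frequently.of_forall fun n => ?_)
    have hlt : t / ((n : ℝ) + 2) < t := div_lt_self ht (by linarith [n.cast_nonneg (α := ℝ)])
    have hs : t - t / ((n : ℝ) + 2) ∈ Ioc (0 : ℝ) t := ⟨by linarith, sub_le_self _ (by positivity)⟩
    rw [hagree _ hs, H_update_phaseStep S hS g φ Z i]
  have heq : EqOn Hc (fun z => c * Complex.exp (Complex.I * (z * (f : ℂ)))) (ball (t : ℂ) ρ') :=
    hHc_an.eqOn_of_preconnected_of_frequently_eq hE_an (convex_ball _ _).isPreconnected (mem_ball_self hρ') hfreq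
  -- Step 2: evaluate below the axis.
  have key : ∀ ρ'' : ℝ, 0 < ρ'' → ρ'' < ρ' → ρ'' * f ≤ 2 + Real.log (A' / A) := by
    intro ρ'' h0 h1
    have hz : (t : ℂ) - (ρ'' : ℂ) * Complex.I ∈ ball (t : ℂ) ρ' := by
      rw [mem_ball, dist_eq_norm, sub_sub_cancel_left, norm_neg, norm_mul, Complex.norm_I, mul_one, Complex.norm_real, Real.norm_eq_abs,
        abs_of_pos h0]
      exact h1
    have hb := hbound _ (hBO hz)
    rw [heq hz, norm_mul, hc, norm_cexp_I_mul_mul_ofReal] at hb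
    have him : ((t : ℂ) - (ρ'' : ℂ) * Complex.I).im = -ρ'' := by simp
    rw [him, neg_mul, neg_neg] at hb
    -- hb : A e^{-2} e^{-Rd} · e^{ρ'' f} ≤ A' e^{-Rd}
    have hexp : 0 < Real.exp (-(R * (domSys P M (k + 1)).dj Z)) := Real.exp_pos _
    have h2 : A * (Real.exp (-2) * Real.exp (ρ'' * f)) ≤ A' := by
      have := hb; nlinarith [Real.exp_pos (-2), Real.exp_pos (ρ'' * f)]
    rw [← Real.exp_add, ← le_div_iff₀' hA] at h2
    have h3 := Real.log_le_log (Real.exp_pos _) h2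
    rw [Real.log_exp] at h3
    linarith
  -- Step 3: let ρ'' ↑ ρ'.
  by_contra hlt
  rw [not_le] at hlt
  set C : ℝ := 2 + Real.log (A' / A) with hC_def
  have hCf : max (C / f) 0 < ρ' := max_lt ((div_lt_iff₀ hf).2 hlt) hρ'
  have h1 : max (C / f) 0 < (max (C / f) 0 + ρ') / 2 := by linarith
  have h2 : (max (C / f) 0 + ρ') / 2 < ρ' := by linarith
  have h3 : 0 < (max (C / f) 0 + ρ') / 2 := lt_of_le_of_lt (le_max_right _ _) h1
  have h4 := key _ h3 h2
  have h5 : C / f < (max (C / f) 0 + ρ') / 2 := lt_of_le_of_lt (le_max_left _ _) h1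
  rw [div_lt_iff₀ hf] at h5
  linarith

/-- **AT THE SAME AMPLITUDE THE STRIP IS MAXIMAL**: with `A′ = A` a margin datum about `t > 0` in the coordinate `g_i` has radius `ρ′ ≤ 2·ϱ·(ω^{k+1−i})⁻¹` — twice the
geometric table, i.e. exactly the half-width of the strip exhibited by `coordHolo_phaseStep`. [folklore] -/
theorem margin_radius_le_two_mul_phaseStep (hA : 0 < A) (hϱ : 0 < ϱ) (hω : 0 < ω) (g : Fin (k + 1) → ℝ) (φ : CPair P 𝔸)
    (Z : (domSys P M (k + 1)).Dom) (i : Fin (k + 1)) {t ρ' : ℝ} (ht : 0 < t) (hρ' : 0 < ρ') {Hc : ℂ → ℂ} {O : Set ℂ}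
    (hdiff : DifferentiableOn ℂ Hc O) (hball : closedBall (t : ℂ) ρ' ⊆ O)
    (hbound : ∀ z ∈ O, ‖Hc z‖ ≤ A * Real.exp (-(R * (domSys P M (k + 1)).dj Z)))
    (hagree : ∀ s ∈ Ioc (0 : ℝ) t, Hc s = S.H (Function.update g i s) φ Z) :
    ρ' ≤ 2 * (ϱ * (ω ^ (k + 1 - (i : ℕ)))⁻¹) := by
  have h := margin_radius_le_phaseStep S hS hA hϱ hω g φ Z i ht hρ' hdiff hball hbound hagree
  rw [div_self hA.ne', Real.log_one, add_zero] at h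
  have hωp : 0 < ω ^ (k + 1 - (i : ℕ)) := pow_pos hω _
  rw [show 2 * (ϱ * (ω ^ (k + 1 - (i : ℕ)))⁻¹) = 2 / (ω ^ (k + 1 - (i : ℕ)) / ϱ) by field_simp, le_div_iff₀ (by positivity)]
  exact h

end Step

/-! ## The tower-level form: J31's level-`k` datum shape with ANY radius table forces at most (log-corrected) geometric growth -/

section Tower
variable (F : T4Family) (K : ℕ) {𝔸 : Type*} {M : ℕ} (S : ClusterTower (F.P K) 𝔸 M) {A R ϱ ω : ℝ}
variable (hS : ∀ (k : ℕ) (g : Fin (k + 1) → ℝ) (φ : CPair (F.P K) 𝔸) (Z : (domSys (F.P K) M (k + 1)).Dom),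
  (S k).H g φ Z = ((A * Real.exp (-2) * Real.exp (-(R * (domSys (F.P K) M (k + 1)).dj Z)) : ℝ) : ℂ) *
    Complex.exp (Complex.I * ((∑ i : Fin (k + 1), g i * (ω ^ (k + 1 - (i : ℕ)) / ϱ) : ℝ) : ℂ)))
include hS

/-- **★ NO FASTER-THAN-GEOMETRIC MARGINS AT THE PHASE TOWER.**  If at some level `k` the phase tower carries J31's margin datum (the shape `hH` of g2's ★
`ne9_and_fadingMemory_functionalOn_of_coordHoloRadii`) on a box `]0, γ]^{k+1}` with `γ > 0`, some polymer whose space table is inhabited, ANY positive radius table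
`ρ′` and ANY amplitude `A′`, then `ρ′ (k+1) i · ω^{k+1−i}∕ϱ ≤ 2 + log(A′∕A)` for every coordinate `i ≤ k`: the radii any producer can display for THIS tower grow in the
age at most like `ω^{−(k+1−i)}` (times `(2 + log(A′∕A))·ϱ`) — the geometric growth letter of `…FadingMemoryOfCouplingRadii` is SHARP here, rate-wise.
[cite: Balaban1987RG1, §1 p.263; Balaban1988RG2Cluster, Lemma 3 (2.38) p.20] -/
theorem margin_table_le_phaseTower (hA : 0 < A) (hϱ : 0 < ϱ) (hω : 0 < ω) {γ : ℝ} (hγ : 0 < γ) {k : ℕ}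
    {sp : (domSys (F.P K) M (k + 1)).Dom → Set (CPair (F.P K) 𝔸)} {Z : (domSys (F.P K) M (k + 1)).Dom} {φ : CPair (F.P K) 𝔸} (hφ : φ ∈ sp Z)
    {ρ' : ℕ → ℕ → ℝ} (hρ'pos : ∀ n i, 0 < ρ' n i) {A' : ℝ}
    (hH : ∀ g ∈ box γ k, ∀ Z, ∀ φ ∈ sp Z, ∀ i : Fin (k + 1),
      ∃ (Hc : ℂ → ℂ) (O : Set ℂ), DifferentiableOn ℂ Hc O ∧ (∀ t ∈ Ioc (0 : ℝ) γ, closedBall (t : ℂ) (ρ' (k + 1) i) ⊆ O) ∧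
        (∀ z ∈ O, ‖Hc z‖ ≤ A' * Real.exp (-(R * (domSys (F.P K) M (k + 1)).dj Z))) ∧
        (∀ t ∈ Ioc (0 : ℝ) γ, Hc t = (S k).H (Function.update g i t) φ Z))
    (i : Fin (k + 1)) :
    ρ' (k + 1) i * (ω ^ (k + 1 - (i : ℕ)) / ϱ) ≤ 2 + Real.log (A' / A) := by
  have hg : (fun _ : Fin (k + 1) => γ) ∈ box γ k := fun _ => ⟨hγ, le_rfl⟩
  obtain ⟨Hc, O, hdiff, hball, hbound, hagree⟩ := hH _ hg Z φ hφ i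
  exact margin_radius_le_phaseStep (S k) (hS k) hA hϱ hω _ φ Z i hγ (hρ'pos _ _) hdiff (hball γ ⟨hγ, le_rfl⟩) hbound hagree

end Tower

end YMDAG.N22.W1.CouplingRadii.PhaseTower

end
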